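import Literature.MathematicalPhysics.QuantumFieldTheory.Balaban1983to89.B2Eq265PrintedForm

/-!
# `Balaban1983to89.B2Eq265TailsPow` — [Balaban1982Higgs2] Lemma 2.4 (2.65) p.572, value clause, on the (Higgs)₂,₃ carrier of record: the
# two (2.67) tails of F13's bound in print's `O((Lᵏε)^κ)` form — (2.67) p.572, AS PRINTED (render transcription of record of own
# `B2Eq267HiggsRegionAsPrinted`): «Using Proposition 2.2 and the restrictions (2.55) we get φ^{(k)}(x) = (a_kG_k(□, A^{(k)})Q_k^*(A^{(k)})□₁φ)(x)
# + O((Lᵏε)^κ), x ∈ Bᵏ(y), (2.67)» — once the radii are read as in print (`m ≥ θ₁r(Lᵏε)`, `R₁ + 1 ≥ θ₂r(Lᵏε)`; print: `4r`, `2r`) and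
# the `φ`-threshold `t′ = c₁·tPhi·pℓ` has polynomial size `≤ T(Lᵏε)^{−m′}` ((2.55)₄ with `λ(ε) = λε^{4−d}`), by r14's «`e^{−δr(Lᵏε)}` beats
# every power» (`B2StepK.rDecayBeatsPowers_of_printed`), exactly as own gen-18 `B2Eq267HiggsRegionAsPrinted.eq267_higgs_region_pow` did
# for (2.67) alone (`eq265_higgs_region_pow`)

statement-level skeleton of published theorems with citation tags; proofs where landed; nothing here is a claim
about the Yang–Mills mass gap

PDF held: `paper:balaban1982-cmp86-higgs23-ii` (journal page = PDF page + 554), p. 572 [PDF 18] (Lemma 2.4, (2.67)), p. 558 [PDF 4] ((2.7)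
«r(ε) = R(1 + log ε⁻¹)^r … r > 1»), p. 557 [PDF 3] ((2.2)/(2.5)).

CITATION HEADER (lean-in-tree rule).  T. Bałaban, *(Higgs)₂,₃ quantum fields in a finite volume. II. An upper bound*,
Commun. Math. Phys. **86** (1982) 555–594, doi:10.1007/bf01214890 [Balaban1982Higgs2].  Cell `lit-balaban` (HOME
`run/shared/lean/pub/lit-balaban/`), Phase-2 proof seat **p23** gen 22 (unit `lit-balaban-p23-g22`; free-target protocol G.5-34(d), TAKING #8
line HOME/STATUS.md 2026-08-23); SKELETON row **B2.Lem2.4** (fold owner r02, second reader r14; head `proved p250408 · …` UNCHANGED —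
cells-only member, brick F15).  USED BY NAME, never restated: own F13 `B2Eq265PrintedForm.eq265_higgs_region_tails`, r14's
`B2StepK.rDecayBeatsPowers_of_printed` ((2.7)/(2.109): `e^{−δ₁r(ℓ)} ≤ C_κ ℓ^κ` on `0 < ℓ ≤ 1` for the printed ranges `B2.Params.Printed`),
b2b's `B2.rFn` ((2.7) `r(ε) = R(1 + log ε⁻¹)^r`).

THE ARGUMENT.  F13's first summand is `a_k t′[C₁e^{−m/(4K₀)} + C₂e^{−(R₁+1)/(4K₀)}]`.  With `m ≥ θ₁r(ℓ)`, `R₁ + 1 ≥ θ₂r(ℓ)` (`ℓ = Lᵏε`) the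
exponentials are `≤ e^{−θᵢr(ℓ)/(4K₀)} ≤ E_i ℓ^{κ+m′}` (`rDecayBeatsPowers` at the rates `θᵢ/(4K₀)`, `K₀ ≥ 1`), and `t′ ≤ Tℓ^{−m′}` absorbs the
threshold: the summand is `≤ (C₁E₁⁺ + C₂E₂⁺)T·a_k·ℓ^κ`; the other six terms are untouched.

WHAT THIS FILE PROVES (kernel-checked, zero `sorry`; theorems only — NO definition, NO `Prop`-valued fact; axioms standard).
 **`eq265_higgs_region_pow`** — F13's `eq265_higgs_region_tails` word for word except (located edits): new leading binders
 `(Q : B2.Params) (hQ : Q.Printed) {T} (hT : 0 ≤ T) (m′ : ℝ) {θ₁ θ₂} (hθ₁ : 0 < θ₁) (hθ₂ : 0 < θ₂) (κ : ℝ)`; the constants gain `∃ C′ ≥ 0`;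
 three hypotheses after the (2.55) letters: `θ₁·r(Lᵏε) ≤ m`, `θ₂·r(Lᵏε) ≤ R₁ + 1`, `c₁·tPhi·pℓ ≤ T(Lᵏε)^{−m′}` (`r = B2.rFn Q.R Q.r`); and in the
 bound the first summand `a_k(c₁·tPhi·pℓ)[C₁e^{−m/(4K₀)} + C₂e^{−(R₁+1)/(4K₀)}]` ↦ `C′·a_k·(Lᵏε)^κ`.

HONEST SCOPE / DIFFERENCES FROM PRINT (recorded, not hidden; one sentence each).  (a) ONLY THE TWO (2.67) TAILS are converted to
`O((Lᵏε)^κ)`; the (2.68)/(2.76)/(2.75)/transport terms stay explicit — their printed sizes `O((Lᵏε)^{κ₀})`/`O(p(Lᵏε))` need the (2.5)–(2.7)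
scaling dictionary of `e(Lᵏε)`, `λ(Lᵏε)`, `p(Lᵏε)` (row B2.Lem2.4's «final SIZE» residue, not evaluated).  (b) `θ₁, θ₂ > 0` are free (print's
geometry is `m ⇐ 4r(Lᵏε)`, `R₁ ⇐ 2r(Lᵏε)` about `y`, i.e. `θ₁ = 4`, `θ₂ = 2` away from `∂Λ₇′`; cf. own gen-18 file for the collar);
`T, m′` free (the printed (2.55)₄ threshold `c₁p(ℓ/L)/λ(ℓ/L)^{1/4}` has such a size by own `B2Eq2108ErrorBound.printedThreshold_thrPhi_le` —
not invoked here); `K₀min` is raised to `max K₀min 1` for `δ₀ = 1/(4K₀) > 0`; `C′ = (C₁E₁⁺ + C₂E₂⁺)T` with r14's existential `E_i`.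
(c) Everything else as in F13's HONEST SCOPE.  NOT summit progress.
-/

open scoped BigOperators

noncomputable section

namespace Literature.MathematicalPhysics.QuantumFieldTheory.Balaban1983to89.B2Eq265TailsPow

open HiggsLattice (ChargeData)
open HiggsAveraging (blockIter toFinest)
open HiggsCovariance (avgQkAdj)
open B2Eq255Concrete (bgScalar256 underRegion mem_underRegion Restr255)
open B2Eq265PrintedForm (eq265_higgs_region_tails)
open B2Lemma23HiggsLattice (cutMin)
open B1Eq211ZeroFieldTorus (Shape)
open B3MultiscaleFields (toSite ofSite)
open B1Ineq225RegularBox (cellBox)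
open B1TorusRegionHSizes (IsBigBlockUnion)
open B1TorusCubeCover (half)
open B1TorusCubeLocality26 (rS)

variable {P : HiggsLattice.Params} {k : ℕ}

/-! ## The (2.67) tails of (2.65) in `O((Lᵏε)^κ)` form -/

section Pow

/-- **LEMMA 2.4 (2.65), VALUE CLAUSE — the (2.67) tails as print's `O((Lᵏε)^κ)`.**  TYPED vs PRINTED: F13's
`B2Eq265PrintedForm.eq265_higgs_region_tails` word for word except the located edits listed in the header (printed ranges `Q.Printed`,
threshold size `T(Lᵏε)^{−m′}`, radii readings `θ₁r(Lᵏε) ≤ m`, `θ₂r(Lᵏε) ≤ R₁ + 1`, exponent `κ`; `∃ C′ ≥ 0`; first summand ↦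
`C′·a_k·(Lᵏε)^κ`). [cite: Balaban1982Higgs2, Lemma 2.4 (2.65) p.572]
[cite: Balaban1982Higgs2, Lemma 2.4 proof (2.67) p.572 «Using Proposition 2.2 and the restrictions (2.55) we get φ^{(k)}(x) = (a_kG_k(□, A^{(k)})Q_k^*(A^{(k)})□₁φ)(x) + O((Lᵏε)^κ), x ∈ Bᵏ(y)»]
[cite: Balaban1982Higgs2, (2.7) p.558 «r(ε) = R(1 + log ε⁻¹)^r»] -/
theorem eq265_higgs_region_pow (d L : ℕ) (hd : 1 ≤ d) (hL : Odd L ∧ 1 < L) {a : ℝ} (ha : 0 < a) {msq : ℝ} (hmsq : 0 < msq)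
    {aV : ℝ} (haV : 0 < aV) {mu0sq : ℝ} (hmu0 : 0 < mu0sq)
    (N : ℕ) (C : ChargeData N) (ε₀ : ℝ) (creg β : ℝ) (hcreg : 0 ≤ creg) (hβ : 0 < β)
    (Q : B2.Params) (hQ : Q.Printed) {T : ℝ} (hT : 0 ≤ T) (mexp : ℝ) {θ₁ θ₂ : ℝ} (hθ₁ : 0 < θ₁) (hθ₂ : 0 < θ₂) (κ : ℝ) :
    ∃ δ CV CF : ℝ, 0 < δ ∧ 0 < CV ∧ 0 < CF ∧
    ∃ K₀min : ℕ, ∀ K₀ : ℕ, K₀min ≤ K₀ → ∃ e₁ t : ℝ, 0 < e₁ ∧ 0 < t ∧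
      ∃ C₁ C₂ C₃ D₁ D₂ D₃ D₄ : ℝ, 0 ≤ C₁ ∧ 0 ≤ C₂ ∧ 0 ≤ C₃ ∧ 0 ≤ D₁ ∧ 0 ≤ D₂ ∧ 0 ≤ D₃ ∧ 0 ≤ D₄ ∧ ∃ C' : ℝ, 0 ≤ C' ∧
      ∀ (P : HiggsLattice.Params) (_ : Shape P), P.d = d → P.L = L → K₀ ∣ P.M →
      ∀ {k : ℕ}, 1 ≤ k → k ≤ P.K → (∀ μ, 3 * half P k K₀ ≤ P.sitesPerDir 0 μ) → P.mesh k ≤ ε₀ → P.mesh k ≤ 1 →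
      ∀ (Λ₂ Λ₆ sq₂ sq₁ : Finset (HiggsLattice.Site P k)) (S : Fin P.d → Finset ℕ) (q : HiggsLattice.Site P k) (Sbox : ℕ),
        Λ₆ ⊆ Λ₂ → sq₂ ⊆ Λ₂ → sq₁ ⊆ Λ₆ →
        IsBigBlockUnion k K₀ (underRegion k Λ₂) → underRegion k sq₂ = cellBox k K₀ S →
        (∀ μ : Fin P.d, P.L ^ k * Sbox < P.sitesPerDir 0 μ) →
      -- `□₂` IS the box `q + [0,S)ᵈ` of coarse sites, `□ = B^k(□₂)` smaller than half the torus
        (∀ y : HiggsLattice.Site P k, y ∈ sq₂ ↔ ∀ ν : Fin P.d, (y ν - q ν).val < Sbox) →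
        (∀ μ : Fin P.d, 2 * (P.L ^ k * Sbox) ≤ P.sitesPerDir 0 μ) →
      -- `□₁` is the box of coarse sites of radius `R₁` (corner `q₁`); `m ≥ R₁` a coarse margin with `Lᵏm ≥` the depth radius
      ∀ (q₁ : HiggsLattice.Site P k) (R₁ m : ℕ), R₁ ≤ m → 2 * rS P k K₀ + 2 * half P k K₀ * (P.d + 1) + 1 ≤ P.L ^ k * m →
        (∀ y : HiggsLattice.Site P k, y ∈ sq₁ ↔ ∀ ν : Fin P.d, (y ν - q₁ ν).val < 2 * R₁ + 1) →
      -- the region `Λ₋₁` of (2.55); the cutoff `ζ^{(k)}` of (2.44); the cube of radius `R_n ≥ ρ + 1` about every `y ∈ Λ₂` inside `Λ₋₁` ((2.8))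
      ∀ (Λm1 : Finset (HiggsLattice.Site P k))
        (ζ : HiggsLattice.Site P 0 → HiggsLattice.Site P k → ℝ) (ρ ρ₁ : ℝ), 0 ≤ ρ₁ →
        (∀ x y', |ζ x y'| ≤ 1) →
        (∀ x y', ζ x y' ≠ 0 → (HiggsLattice.Site.tdist (blockIter k x) y' : ℝ) ≤ ρ) →
        (∀ x y', (HiggsLattice.Site.tdist (blockIter k x) y' : ℝ) ≤ ρ₁ → ζ x y' = 1) →
        (∀ (x : HiggsLattice.Site P 0) (ν : Fin P.d) (y' : HiggsLattice.Site P k), |ζ (x.shift ν) y' - ζ x y'| ≤ ((P.L : ℝ) ^ k)⁻¹) →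
      ∀ (Rn : ℕ), ρ + 1 ≤ (Rn : ℝ) → (∀ μ : Fin P.d, 2 * (2 * Rn + 1) ≤ P.sitesPerDir k μ) →
        (∀ y ∈ Λ₂, ∀ y' : HiggsLattice.Site P k, HiggsLattice.Site.tdist y y' ≤ Rn → y' ∈ Λm1) →
      -- a charge datum on `ℝ^d`, the step's vector field `A′`, and the letters of (2.55)
      ∀ (C₀ : ChargeData P.d) (A' : HiggsLattice.VecField P k) {c₁ pℓ tA tPhi : ℝ}, 0 ≤ c₁ → 0 ≤ pℓ → 0 ≤ tPhi →
      -- the printed readings of the radii and a polynomial size of the `φ`-threshold: `m ≥ θ₁r(Lᵏε)`, `R₁ + 1 ≥ θ₂r(Lᵏε)`, `c₁·tPhi·pℓ ≤ T(Lᵏε)^{−m′}`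
        θ₁ * B2.rFn Q.R Q.r (P.mesh k) ≤ (m : ℝ) → θ₂ * B2.rFn Q.R Q.r (P.mesh k) ≤ (R₁ : ℝ) + 1 →
        c₁ * tPhi * pℓ ≤ T * P.mesh k ^ (-mexp) →
      -- `δA` is at least the (2.60) bound read off (2.55)₁,₂, and small in the two printed scalings
      ∀ {δA : ℝ}, ((P.L : ℝ) ^ k)⁻¹ * (CV * P.d * (P.mesh k * (c₁ * pℓ)) + CF * Real.exp (-(δ * ρ₁)) * (c₁ * tA * pℓ)) ≤ δA →
          (P.L : ℝ) ^ k * δA * |C.e| ≤ t →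
        ∀ {ec : ℝ}, 0 < ec → ec ≤ e₁ → (P.L : ℝ) ^ k * P.mesh k * |C.e| * δA ≤ creg * ec ^ β →
      -- `x ∈ Bᵏ(ȳ)` with `ȳ` the centre of `□₁` and at least `m` inside `□₂` in every direction
      ∀ (x : HiggsLattice.Site P 0),
        (∀ ν : Fin P.d, m ≤ ((blockIter k x) ν - q ν).val ∧ ((blockIter k x) ν - q ν).val + m < Sbox) →
        (∀ ν : Fin P.d, ((blockIter k x) ν - q₁ ν).val = R₁) →
      -- THE RESTRICTIONS (2.55) on `Λ₋₁` for the fields `A′, φ` of the step and the background `A^{(k)} = a_kζ^{(k)}G_kQ_k^*A′` — all four conjuncts used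
      ∀ (φ : HiggsLattice.ScalarField P k N),
        Restr255 C c₁ pℓ tA tPhi k Λm1 A' φ (ofSite (cutMin C₀ mu0sq aV k ζ (toSite A'))) →
        ‖bgScalar256 C msq a k Λ₂ Λ₆ (ofSite (cutMin C₀ mu0sq aV k ζ (toSite A'))) φ x
            - avgQkAdj C (ofSite (cutMin C₀ mu0sq aV k ζ (toSite A'))) k φ x‖
          ≤ C' * B1.aSeq a P.L k * P.mesh k ^ κ
            + (D₁ * P.mesh k ^ 2 *
                (B1.aSeq a P.L k * (P.mesh k)⁻¹ ^ 2 * (|C.e| * (δA * (P.d * ((P.L : ℝ) ^ k * Sbox))) * P.mesh 0 * (P.d * ((P.L : ℝ) ^ k - 1))) * (c₁ * tPhi * pℓ)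
                  + |C.e| * (δA * (P.d * ((P.L : ℝ) ^ k * Sbox))) * (P.d * ((B1.aSeq a P.L k * (P.mesh k)⁻¹ ^ 2 * (c₁ * tPhi * pℓ) * D₄ * P.mesh k
                        + |C.e| * (δA * (P.d * ((P.L : ℝ) ^ k * Sbox))) * (B1.aSeq a P.L k * D₃ * (c₁ * tPhi * pℓ))) + |C.e| * (δA * (P.d * ((P.L : ℝ) ^ k * Sbox))) * (B1.aSeq a P.L k * D₃ * (c₁ * tPhi * pℓ))))
                  + B1.aSeq a P.L k * (P.mesh k)⁻¹ ^ 2 *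
                      ((2 * (|C.e| * (δA * (P.d * ((P.L : ℝ) ^ k * Sbox))) * P.mesh 0 * (P.d * ((P.L : ℝ) ^ k - 1)))
                        + (|C.e| * (δA * (P.d * ((P.L : ℝ) ^ k * Sbox))) * P.mesh 0 * (P.d * ((P.L : ℝ) ^ k - 1))) ^ 2) * (B1.aSeq a P.L k * D₃ * (c₁ * tPhi * pℓ))))
              + D₂ * P.mesh k * (|C.e| * (δA * (P.d * ((P.L : ℝ) ^ k * Sbox))) * (B1.aSeq a P.L k * D₃ * (c₁ * tPhi * pℓ))))
            + B1.aSeq a P.L k * C₃ *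
                (4 * K₀ * ((P.mesh k * (c₁ * pℓ) + P.mesh k * |C.e| * (δA * (P.d * ((P.L : ℝ) ^ k * Sbox))) * (c₁ * tPhi * pℓ)) * P.d)
                  + Real.exp (-(1 / (4 * K₀) * ((R₁ : ℝ) + 1))) * (c₁ * tPhi * pℓ))
            + msq * P.mesh k ^ 2 / (B1.aSeq a P.L k + msq * P.mesh k ^ 2) * (c₁ * tPhi * pℓ)
            + |C.e| * P.mesh 0 * (P.d * ((P.L : ℝ) ^ k - 1)) * (δA * (P.d * ((P.L : ℝ) ^ k * Sbox))) * (c₁ * tPhi * pℓ) := by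
  obtain ⟨δ, CV, CF, hδ, hCV, hCF, K₀min, h⟩ := eq265_higgs_region_tails d L hd hL ha hmsq haV hmu0 N C ε₀ creg β hcreg hβ
  refine ⟨δ, CV, CF, hδ, hCV, hCF, max K₀min 1, fun K₀ hK₀ => ?_⟩
  obtain ⟨e₁, t, he₁, ht, C₁, C₂, C₃, D₁, D₂, D₃, D₄, hC₁, hC₂, hC₃, hD₁, hD₂, hD₃, hD₄, h⟩ := h K₀ ((le_max_left _ _).trans hK₀)
  have hK₀1 : (1 : ℝ) ≤ K₀ := by exact_mod_cast (le_max_right _ _).trans hK₀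
  have hδ₀ : (0 : ℝ) < 1 / (4 * K₀) := by positivity
  have hr₁ : (0 : ℝ) < θ₁ * (1 / (4 * K₀)) := by positivity
  have hr₂ : (0 : ℝ) < θ₂ * (1 / (4 * K₀)) := by positivity
  obtain ⟨E₁, hE₁⟩ := B2StepK.rDecayBeatsPowers_of_printed Q hQ hr₁ (κ + mexp)
  obtain ⟨E₂, hE₂⟩ := B2StepK.rDecayBeatsPowers_of_printed Q hQ hr₂ (κ + mexp)
  -- `E₁, E₂ ≥ 0` may fail for the abstract constants; use their positive parts
  refine ⟨e₁, t, he₁, ht, C₁, C₂, C₃, D₁, D₂, D₃, D₄, hC₁, hC₂, hC₃, hD₁, hD₂, hD₃, hD₄,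
    (C₁ * max E₁ 0 + C₂ * max E₂ 0) * T, by positivity, ?_⟩
  intro P S hPd hPL hK₀M k hk1 hkK h3 hε h1 Λ₂ Λ₆ sq₂ sq₁ Sfin q Sbox h62 hs2 h16 hΩΛ hbox hSbox hsq₂ h2S q₁ R₁ m hR₁m hRm hsq₁
    Λm1 ζ ρ ρ₁ hρ₁ zeta_abs zeta_supp zeta_one zeta_lip Rn hRn hRn2 hcube C₀ A' c₁ pℓ tA tPhi hc₁ hpℓ htPhi hθm hθR htT δA h60δ
    ht' ec hec hle hsmall x hmargin hcentre φ h255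
  have hmain := h P S hPd hPL hK₀M hk1 hkK h3 hε h1 Λ₂ Λ₆ sq₂ sq₁ Sfin q Sbox h62 hs2 h16 hΩΛ hbox hSbox hsq₂ h2S q₁ R₁ m hR₁m hRm hsq₁
    Λm1 ζ ρ ρ₁ hρ₁ zeta_abs zeta_supp zeta_one zeta_lip Rn hRn hRn2 hcube C₀ A' hc₁ hpℓ htPhi h60δ ht' hec hle hsmall x hmargin hcentre φ
    h255
  -- the two tails beat every power of `ℓ = Lᵏε`
  set ℓ := P.mesh k with hℓdef
  have hℓ : 0 < ℓ := P.mesh_pos k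
  set r := B2.rFn Q.R Q.r ℓ with hrdef
  have hLr : 1 < (P.L : ℝ) := by rw [hPL]; exact_mod_cast hL.2
  have hak : 0 ≤ B1.aSeq a P.L k := (B1.aSeq_pos ha hLr hk1).le
  have ht0 : 0 ≤ c₁ * tPhi * pℓ := mul_nonneg (mul_nonneg hc₁ htPhi) hpℓ
  have hm' : θ₁ * (1 / (4 * K₀)) * r ≤ 1 / (4 * K₀) * (m : ℝ) := by
    have h' := mul_le_mul_of_nonneg_left hθm hδ₀.le
    calc θ₁ * (1 / (4 * K₀)) * r = 1 / (4 * K₀) * (θ₁ * r) := by ring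
      _ ≤ 1 / (4 * K₀) * (m : ℝ) := h'
  have hR' : θ₂ * (1 / (4 * K₀)) * r ≤ 1 / (4 * K₀) * ((R₁ : ℝ) + 1) := by
    have h' := mul_le_mul_of_nonneg_left hθR hδ₀.le
    calc θ₂ * (1 / (4 * K₀)) * r = 1 / (4 * K₀) * (θ₂ * r) := by ring
      _ ≤ 1 / (4 * K₀) * ((R₁ : ℝ) + 1) := h'
  have hex₁ : Real.exp (-(1 / (4 * K₀) * (m : ℝ))) ≤ max E₁ 0 * ℓ ^ (κ + mexp) := by
    calc Real.exp (-(1 / (4 * K₀) * (m : ℝ))) ≤ Real.exp (-(θ₁ * (1 / (4 * K₀)) * r)) :=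
          Real.exp_le_exp.mpr (neg_le_neg hm')
      _ ≤ E₁ * ℓ ^ (κ + mexp) := hE₁ ℓ hℓ h1
      _ ≤ max E₁ 0 * ℓ ^ (κ + mexp) := mul_le_mul_of_nonneg_right (le_max_left _ _) (Real.rpow_nonneg hℓ.le _)
  have hex₂ : Real.exp (-(1 / (4 * K₀) * ((R₁ : ℝ) + 1))) ≤ max E₂ 0 * ℓ ^ (κ + mexp) := by
    calc Real.exp (-(1 / (4 * K₀) * ((R₁ : ℝ) + 1))) ≤ Real.exp (-(θ₂ * (1 / (4 * K₀)) * r)) :=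
          Real.exp_le_exp.mpr (neg_le_neg hR')
      _ ≤ E₂ * ℓ ^ (κ + mexp) := hE₂ ℓ hℓ h1
      _ ≤ max E₂ 0 * ℓ ^ (κ + mexp) := mul_le_mul_of_nonneg_right (le_max_left _ _) (Real.rpow_nonneg hℓ.le _)
  have hpow : ℓ ^ (-mexp) * ℓ ^ (κ + mexp) = ℓ ^ κ := by
    rw [← Real.rpow_add hℓ]; ring_nf
  have hsum0 : 0 ≤ C₁ * Real.exp (-(1 / (4 * K₀) * (m : ℝ))) + C₂ * Real.exp (-(1 / (4 * K₀) * ((R₁ : ℝ) + 1))) :=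
    add_nonneg (mul_nonneg hC₁ (Real.exp_nonneg _)) (mul_nonneg hC₂ (Real.exp_nonneg _))
  have hTm : 0 ≤ T * ℓ ^ (-mexp) := mul_nonneg hT (Real.rpow_nonneg hℓ.le _)
  have hfirst : B1.aSeq a P.L k * (c₁ * tPhi * pℓ) *
        (C₁ * Real.exp (-(1 / (4 * K₀) * (m : ℝ))) + C₂ * Real.exp (-(1 / (4 * K₀) * ((R₁ : ℝ) + 1))))
      ≤ (C₁ * max E₁ 0 + C₂ * max E₂ 0) * T * B1.aSeq a P.L k * ℓ ^ κ := by
    calc B1.aSeq a P.L k * (c₁ * tPhi * pℓ) *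
          (C₁ * Real.exp (-(1 / (4 * K₀) * (m : ℝ))) + C₂ * Real.exp (-(1 / (4 * K₀) * ((R₁ : ℝ) + 1))))
        ≤ B1.aSeq a P.L k * (T * ℓ ^ (-mexp)) *
          (C₁ * Real.exp (-(1 / (4 * K₀) * (m : ℝ))) + C₂ * Real.exp (-(1 / (4 * K₀) * ((R₁ : ℝ) + 1)))) :=
          mul_le_mul_of_nonneg_right (mul_le_mul_of_nonneg_left htT hak) hsum0
      _ ≤ B1.aSeq a P.L k * (T * ℓ ^ (-mexp)) * (C₁ * (max E₁ 0 * ℓ ^ (κ + mexp)) + C₂ * (max E₂ 0 * ℓ ^ (κ + mexp))) :=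
          mul_le_mul_of_nonneg_left (add_le_add (mul_le_mul_of_nonneg_left hex₁ hC₁) (mul_le_mul_of_nonneg_left hex₂ hC₂))
            (mul_nonneg hak hTm)
      _ = (C₁ * max E₁ 0 + C₂ * max E₂ 0) * T * B1.aSeq a P.L k * (ℓ ^ (-mexp) * ℓ ^ (κ + mexp)) := by ring
      _ = (C₁ * max E₁ 0 + C₂ * max E₂ 0) * T * B1.aSeq a P.L k * ℓ ^ κ := by rw [hpow]
  exact hmain.trans (add_le_add (add_le_add (add_le_add (add_le_add hfirst le_rfl) le_rfl) le_rfl) le_rfl)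

end Pow

end Literature.MathematicalPhysics.QuantumFieldTheory.Balaban1983to89.B2Eq265TailsPow

end
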